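import Literature.MathematicalPhysics.QuantumFieldTheory.Balaban1983to89.B4Thm110RegionLpDeriv
import Literature.MathematicalPhysics.QuantumFieldTheory.Balaban1983to89.B4Thm19BoxHolderWalk

/-!
# `Balaban1983to89.B4HolderLetterRegion` — [Balaban1983RegularityDecay] THEOREM p. 573, INEQUALITY (1.9): THE PER-CUBE
# HÖLDER LETTER `‖P_H·h_jG_k(□_j,Ã_j)h_j‖` ON A GENERAL REGION `Ω` IS THE BOX LETTER — the Hölder probe
# `P_H = σ(E_{xy′}[U(A(Γ))U(A_{x′y′})] − E_{xx′}[U(A(Γ))] − (E_{xy}[U(A_{xy})] − E_{xx}[1]))` at four points and a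
# contour inside the `¾M`-core of an interior cube passes through the padding of `B4CubeGreenRegion`, so p17's η-uniform
# `B4HolderLetterBox.holder_letter_box` applies verbatim

statement-level skeleton of published theorems with citation tags; proofs where landed; nothing here is a claim about the Yang–Mills mass gap

WHAT THIS FILE DOES.  `B4Thm110RegionLpDeriv.probe_atGreen_le` moved the DERIVATIVE probe of (1.10) through the padded
box Green's function of an interior cube of a general region `Ω`.  Here the same is done for the HÖLDER probe of (1.9)
(p. 573 «|x − x′|^{−α}|U(A(Γ_{x,x′}))(D^η_{A,μ}G f)(x′) − (D^η_{A,μ}G f)(x)|», `Γ_{x,x′}` a shortest contour): §1 the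
padding algebra of the block-matrix units and of parallel transports (`pad_smul`, `unitOp_eq_pad`, `transport_map`,
`transport_congr`, `pathEnd_map`); §2 nearest-neighbour chains under the translation `boxEmb` of `B4RegionCubeCarrier`
(`isNNChain_map_boxEmb`, `boxEmb_sub_boxEmb`); §3 **`holder_letter_region`**: for an interior cube `□_j` (`□̂_j ⊆ Ω`)
whose `¾M`-core contains the four points `x, x+e_μ, x′, x′+e_μ` and the contour, the letter
`‖(η^{-1}(η^{-1}|x−x′|)^{−α})·P_H·(h_jG_k(□_j,Ã_j)h_j)‖_{ℓ∞→ℓ∞}` of the REGION's cube propagator `atGreen` equals the box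
letter of `B4HolderLetterBox` (the probe and the letter are paddings along `boxEmb`, `pad` is multiplicative and
isometric, the harmless diagonal off the cube is not seen), hence is bounded, UNIFORMLY IN `η`, by
`√N(c_H + (d+1)D₁c_D + (d+3)s c_D + (d+1)(D₁²+D₂)c_G)` from the box inputs `c_G, c_D` (Lemma 2.2 (2.17) sup members)
and `c_H` (Lemma 2.2 (2.16) Hölder member) at `Ã_j`.

HONEST SCOPE.  Abelian one-parameter flow, component fields, staircase contours on the box; the contour `Γ_{x,x′}` is any
nearest-neighbour chain of length `≤ (d+1)|x−x′|_∞` inside the core (the print's «shortest contour»); nothing about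
(1.11)–(1.12) here.  Every declaration is a definition-free theorem; no `Prop` fact, no `sorry`; axioms standard.
-/

namespace Literature.MathematicalPhysics.QuantumFieldTheory.Balaban1983to89.B4HolderLetterRegion

open Literature.MathematicalPhysics.QuantumFieldTheory.Balaban1983to89.B4Reflection242 (boxDom mem_boxDom nbrs mem_nbrs
  blk blk_mem_boxDom)
open Literature.MathematicalPhysics.QuantumFieldTheory.Balaban1983to89.B4GaugeCovariance
open Literature.MathematicalPhysics.QuantumFieldTheory.Balaban1983to89.B4Commutators25to211 (mulH opK)
open Literature.MathematicalPhysics.QuantumFieldTheory.Balaban1983to89.B4Lower18 (fineDom mem_fineDom IsBlockUnion)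
open Literature.MathematicalPhysics.QuantumFieldTheory.Balaban1983to89.B4Lower18Regular (e1 baseEmb stairContour
  base_le_of_blk)
open Literature.MathematicalPhysics.QuantumFieldTheory.Balaban1983to89.B4Lower18RegularRegion (regWt rBlkWt rbaseEmb
  rstairContour regWt_nonneg rBlkWt_ne_zero compField)
open Literature.MathematicalPhysics.QuantumFieldTheory.Balaban1983to89.B4Lemma21Region (regionOp regionDeriv siteNorm
  covDeriv fld_covDeriv_mulVec_of_mem)
open Literature.MathematicalPhysics.QuantumFieldTheory.Balaban1983to89.B4Lemma22ReduceZero (Box opA greenA derivA)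
open Literature.MathematicalPhysics.QuantumFieldTheory.Balaban1983to89.B4Lemma22Reduce231 (supN supN_nonneg le_supN
  supN_le siteNorm_nonneg siteNorm_zero fld_add)
open Literature.MathematicalPhysics.QuantumFieldTheory.Balaban1983to89.B4PartitionUnity22 (hCube hCube_nonneg hCube_le_one
  hCube_ne_zero_imp mem_box_of_hCube_ne_zero hprof D1 D2 D1_nonneg D2_nonneg contDiff_hprof hasCompactSupport_hprof)
open Literature.MathematicalPhysics.QuantumFieldTheory.Balaban1983to89.B4Eq220PartitionSizes (hZ hBox)
open Literature.MathematicalPhysics.QuantumFieldTheory.Balaban1983to89.B4CubeFields22 (cubeField cubeField_eq_compField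
  cubeField_antisymm)
open Literature.MathematicalPhysics.QuantumFieldTheory.Balaban1983to89.B4Eq221L2FactorRegion (acBond)
open Literature.MathematicalPhysics.QuantumFieldTheory.Balaban1983to89.B4CubeOpReindex
open Literature.MathematicalPhysics.QuantumFieldTheory.Balaban1983to89.B4Ineq110WalkRouteDeriv (unitOp_apply)
open Literature.MathematicalPhysics.QuantumFieldTheory.Balaban1983to89.B4WalkRouteRegion (rpos labels labels_complete)
open Literature.MathematicalPhysics.QuantumFieldTheory.Balaban1983to89.B4ContourShift (supNorm supNorm_nonneg)
open Literature.MathematicalPhysics.QuantumFieldTheory.Balaban1983to89.B4Lemma22HolderBox (IsNNChain pathSum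
  transport_fieldLink)
open Literature.MathematicalPhysics.QuantumFieldTheory.Balaban1983to89.B4HolderLetterBox (holder_letter_box)
open Literature.MathematicalPhysics.QuantumFieldTheory.Balaban1983to89.B4RegionCubeCarrier
open Literature.MathematicalPhysics.QuantumFieldTheory.Balaban1983to89.B4CubeGreenRegion
open Literature.MathematicalPhysics.QuantumFieldTheory.Balaban1983to89.B4Thm110RegionLp
open scoped Matrix
open scoped Matrix.Norms.Operator

noncomputable section

/-! ## §1. Padding algebra of the block-matrix units and of parallel transports -/

section PadAlgebra

variable {κ : Type} [Fintype κ] [DecidableEq κ]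
variable {X X' : Type} [Fintype X] [Fintype X'] [DecidableEq X] [DecidableEq X']

omit [Fintype X] [Fintype κ] [DecidableEq κ] [DecidableEq X'] in
/-- padding is linear: `pad_e(σB) = σ·pad_e(B)`. [cite: Balaban1983RegularityDecay, (2.2) p.575, dictionary] -/
theorem pad_smul (e : X' → X) (σ : ℝ) (B : Matrix (X' × κ) (X' × κ) ℝ) : pad e (σ • B) = σ • pad e B := by
  ext p p'
  simp only [pad, Matrix.of_apply, Matrix.smul_apply, smul_eq_mul, Finset.mul_sum]
  refine Finset.sum_congr rfl fun a _ => Finset.sum_congr rfl fun a' _ => ?_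
  split_ifs <;> simp

omit [Fintype X] [Fintype κ] [DecidableEq κ] in
/-- **the block-matrix unit at two image sites is the padded block-matrix unit**: `E_{e(a)e(b)}[B] = pad_e(E_{ab}[B])`.
[cite: Balaban1983RegularityDecay, (1.3) p.572, (2.2) p.575, dictionary] -/
theorem unitOp_eq_pad {e : X' → X} (he : Function.Injective e) (a b : X') (B : Matrix κ κ ℝ) :
    unitOp (e a) (e b) B = pad e (unitOp a b B) := by
  ext p p'
  rw [unitOp_apply]
  by_cases hp : ∃ c, e c = p.1
  · by_cases hp' : ∃ c', e c' = p'.1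
    · obtain ⟨c, hc⟩ := hp
      obtain ⟨c', hc'⟩ := hp'
      obtain ⟨z, k⟩ := p
      obtain ⟨z', k'⟩ := p'
      simp only at hc hc'
      subst hc; subst hc'
      rw [pad_apply_img he, unitOp_apply]
      simp only [he.eq_iff]
    · rw [pad_apply_of_right e _ p (fun c' h => hp' ⟨c', h⟩), if_neg]
      rintro ⟨-, h2⟩
      exact hp' ⟨b, h2.symm⟩
  · rw [pad_apply_of_left e _ (fun c h => hp ⟨c, h⟩), if_neg]
    rintro ⟨h1, -⟩
    exact hp ⟨a, h1.symm⟩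

omit [Fintype X] [Fintype X'] [DecidableEq X] [DecidableEq X'] in
/-- **parallel transport along an embedded contour is the transport of the pulled-back links**:
`U_W(e(a); e(l)) = U_{W∘(e×e)}(a; l)`. [cite: Balaban1983RegularityDecay, (1.4) p.572, dictionary] -/
theorem transport_map (W : X → X → Matrix κ κ ℝ) (e : X' → X) (a : X') (l : List X') :
    transport W (e a) (l.map e) = transport (fun u v => W (e u) (e v)) a l := by
  induction l generalizing a with
  | nil => rfl
  | cons b l ih => simp only [List.map_cons, transport, ih]

omit [Fintype X] [Fintype X'] [DecidableEq X] [DecidableEq X'] in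
/-- the end point of an embedded contour. [folklore] -/
private theorem pathEnd_map (e : X' → X) (a : X') (l : List X') : pathEnd (e a) (l.map e) = e (pathEnd a l) := by
  induction l generalizing a with
  | nil => rfl
  | cons b l ih => simp only [List.map_cons, pathEnd, ih]

omit [Fintype X] [DecidableEq X] in
/-- transports along a contour only see the links of its consecutive sites. [cite: Balaban1983RegularityDecay, (1.4) p.572] -/
theorem transport_congr {W W' : X → X → Matrix κ κ ℝ} (a : X) (l : List X)
    (h : ∀ u v, (u = a ∨ u ∈ l) → v ∈ l → W u v = W' u v) : transport W a l = transport W' a l := by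
  induction l generalizing a with
  | nil => rfl
  | cons b l ih =>
      simp only [transport]
      have h' : ∀ u v, (u = b ∨ u ∈ l) → v ∈ l → W u v = W' u v := by
        intro u v hu hv
        refine h u v (Or.inr ?_) (List.mem_cons_of_mem b hv)
        rcases hu with rfl | hu
        · exact List.mem_cons_self
        · exact List.mem_cons_of_mem b hu
      rw [h a b (Or.inl rfl) List.mem_cons_self, ih b h']

end PadAlgebra

/-! ## §2. Nearest-neighbour chains under the translation `boxEmb` -/

section Chains

variable {d : ℕ}

/-- the translation `boxEmb` preserves coordinate differences. [cite: Balaban1983RegularityDecay, §2 p.575, dictionary] -/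
theorem boxEmb_sub_boxEmb (ℓ k : ℕ) {Ωc : Finset (Fin (d + 1) → ℤ)} (Ms : Fin (d + 1) → ℕ) (o : Fin (d + 1) → ℤ)
    (ho : ∀ y : ↥(boxDom Ms), (y.1 + o) ∈ Ωc) (u v : ↥(Box d ℓ k Ms)) :
    (boxEmb ℓ k Ms o ho u).1 - (boxEmb ℓ k Ms o ho v).1 = u.1 - v.1 := by
  show (u.1 + _) - (v.1 + _) = _
  abel

/-- the translation `boxEmb` preserves the nearest-neighbour relation. [cite: Balaban1983RegularityDecay, §2 p.575, dictionary] -/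
theorem nbrs_boxEmb_iff (ℓ k : ℕ) {Ωc : Finset (Fin (d + 1) → ℤ)} (Ms : Fin (d + 1) → ℕ) (o : Fin (d + 1) → ℤ)
    (ho : ∀ y : ↥(boxDom Ms), (y.1 + o) ∈ Ωc) (u v : ↥(Box d ℓ k Ms)) :
    (boxEmb ℓ k Ms o ho v).1 ∈ nbrs (boxEmb ℓ k Ms o ho u).1 ↔ v.1 ∈ nbrs u.1 := by
  rw [B4Reflection242.mem_nbrs_iff_sub, B4Reflection242.mem_nbrs_iff_sub, boxEmb_sub_boxEmb]

/-- an embedded nearest-neighbour chain is a nearest-neighbour chain. [cite: Balaban1983RegularityDecay, p.573 «a shortest contour», dictionary] -/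
theorem isNNChain_map_boxEmb (ℓ k : ℕ) {Ωc : Finset (Fin (d + 1) → ℤ)} (Ms : Fin (d + 1) → ℕ) (o : Fin (d + 1) → ℤ)
    (ho : ∀ y : ↥(boxDom Ms), (y.1 + o) ∈ Ωc) (a : ↥(Box d ℓ k Ms)) (l : List ↥(Box d ℓ k Ms))
    (hl : IsNNChain a l) : IsNNChain (boxEmb ℓ k Ms o ho a) (l.map (boxEmb ℓ k Ms o ho)) := by
  induction l generalizing a with
  | nil => trivial
  | cons b l ih =>
      obtain ⟨hb, hl'⟩ := hl
      exact ⟨(nbrs_boxEmb_iff ℓ k Ms o ho a b).2 hb, ih b hl'⟩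

/-- **a nearest-neighbour chain inside the image of `boxEmb` is an embedded box chain** (the contour `Γ_{x,x′}` read on
the translated box). [cite: Balaban1983RegularityDecay, p.573 «a shortest contour», §2 p.575, dictionary] -/
theorem exists_chain_preimage (ℓ k : ℕ) {Ωc : Finset (Fin (d + 1) → ℤ)} (Ms : Fin (d + 1) → ℕ) (o : Fin (d + 1) → ℤ)
    (ho : ∀ y : ↥(boxDom Ms), (y.1 + o) ∈ Ωc) :
    ∀ (x : ↥(fineDom ((ℓ + 1) ^ k) Ωc)) (l : List ↥(fineDom ((ℓ + 1) ^ k) Ωc)) (a0 : ↥(Box d ℓ k Ms)),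
      boxEmb ℓ k Ms o ho a0 = x → IsNNChain x l → (∀ z ∈ l, ∃ c, boxEmb ℓ k Ms o ho c = z) →
      ∃ lB : List ↥(Box d ℓ k Ms), lB.map (boxEmb ℓ k Ms o ho) = l ∧ IsNNChain a0 lB ∧
        boxEmb ℓ k Ms o ho (pathEnd a0 lB) = pathEnd x l ∧ lB.length = l.length := by
  intro x l
  induction l generalizing x with
  | nil => exact fun a0 hx _ _ => ⟨[], rfl, trivial, hx, rfl⟩
  | cons z l ih =>
      intro a0 hx hl hmem
      obtain ⟨c, hc⟩ := hmem z List.mem_cons_self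
      obtain ⟨hz, hl'⟩ := hl
      obtain ⟨lB, h1, h2, h3, h4⟩ := ih z c hc hl' fun z' hz' => hmem z' (List.mem_cons_of_mem z hz')
      refine ⟨c :: lB, by rw [List.map_cons, hc, h1], ⟨?_, h2⟩, h3, by rw [List.length_cons, List.length_cons, h4]⟩
      rw [← nbrs_boxEmb_iff ℓ k Ms o ho a0 c, hc, hx]
      exact hz

end Chains

/-! ## §3. The Hölder letter on a general region is the box letter -/

section Letter

variable {d : ℕ} {ι : Type} [Fintype ι] [DecidableEq ι]

/-- **THE PER-CUBE HÖLDER LETTER OF (1.9) ON A GENERAL REGION `Ω`, UNIFORMLY IN `η`.**  For an interior cube `□_j`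
(`□̂_j ⊆ Ω`) whose `¾M`-core contains the four points `x, y = x + e_μ, x′, y′ = x′ + e_μ` and the nearest-neighbour
contour `Γ = (x, l)` from `x` to `x′` (all read on the translated `2K`-box through `boxEmb`: `x = e(a₀)`, `x′ = e(a₀′)`,
`l = e(l_□)`), the letter of the chain `B4Ineq19LpChain.ineq19_holder_lp` built with the REGION's link variables
`U(A_b)` (`fieldLink F κ (acBond Ωc Ac)`), the transport `U(A(Γ))` along `Γ` and the cube propagator `atGreen` of
`B4Thm110RegionLp`,
`‖(η^{-1}(η^{-1}|x−x′|_∞)^{−α})·(E_{xy′}[U(A(Γ))U(A_{x′y′})] − E_{xx′}[U(A(Γ))] − (E_{xy}[U(A_{xy})] − E_{xx}[1]))·(h_jG_k(□_j,Ã_j)h_j)‖`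
`≤ √N·(c_H + (d+1)D₁c_D + (d+3)·s·c_D + (d+1)(D₁²+D₂)c_G)`, `s = (d+1)(sup|h′|+sup|h″|)`, from the box inputs at `Ã_j`:
`‖G_k(□,Ã)Φ‖_∞ ≤ c_G‖Φ‖_∞`, `‖D^η_{Ã,ν}G_k(□,Ã)Φ‖_∞ ≤ c_D‖Φ‖_∞` (Lemma 2.2 (2.17)) and the Hölder member (2.16) along
`l_□`, `(η^{-1}/|a₀′−a₀|)^α|U(Ã(Γ))(D^η_{Ã,μ}GΦ)(a₀′) − (D^η_{Ã,μ}GΦ)(a₀)| ≤ c_H‖Φ‖_∞` — p17's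
`B4HolderLetterBox.holder_letter_box` moved through the padding (`Ã_j = A` on the core, so the region's links and
transport are the box's; the probe and the letter are paddings; `pad` is multiplicative and isometric).
[cite: Balaban1983RegularityDecay, Theorem (1.9) p.573; (1.3)–(1.4) p.572; (2.2)–(2.3) p.575; Lemma 2.2 (2.16)–(2.17) pp.577–578] -/
theorem holder_letter_region (F : OrthFlow ι) (κ : ℝ) {ℓ k : ℕ} (hn : 1 ≤ (ℓ + 1) ^ k)
    (Ωc : Finset (Fin (d + 1) → ℤ)) {K : ℕ} (hK : 1 ≤ K) (hnK : 3 ≤ (ℓ + 1) ^ k * K)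
    (Ac : (Fin (d + 1) → ℤ) → Fin (d + 1) → ℝ) (a m2 : ℝ) {j : Fin (d + 1) → ℤ} (hgood : cubeLabels K j ⊆ Ωc)
    {cG cD cH : ℝ} (hcG : 0 ≤ cG) (hcD : 0 ≤ cD) (hcH : 0 ≤ cH)
    (hG : ∀ Φ : ↥(Box d ℓ k fun _ : Fin (d + 1) => 2 * K) × ι → ℝ,
      supN (greenA d F κ ℓ k a m2 (fun _ => 2 * K) (baseEmb hn _) (stairContour hn _) (boxFld ℓ k K Ac j) *ᵥ Φ)
        ≤ cG * supN Φ)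
    (hDG : ∀ (ν : Fin (d + 1)) (Φ : ↥(Box d ℓ k fun _ : Fin (d + 1) => 2 * K) × ι → ℝ),
      supN (derivA d F κ ℓ k (fun _ => 2 * K) (boxFld ℓ k K Ac j) ν
        *ᵥ (greenA d F κ ℓ k a m2 (fun _ => 2 * K) (baseEmb hn _) (stairContour hn _) (boxFld ℓ k K Ac j) *ᵥ Φ))
        ≤ cD * supN Φ)
    -- the pair, the bonds and the contour on the box, and their images in the region
    (μ : Fin (d + 1)) (a0 a0' : ↥(Box d ℓ k fun _ : Fin (d + 1) => 2 * K))
    (ha0μ : a0.1 + e1 μ ∈ Box d ℓ k fun _ : Fin (d + 1) => 2 * K)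
    (ha0'μ : a0'.1 + e1 μ ∈ Box d ℓ k fun _ : Fin (d + 1) => 2 * K) (hne : a0'.1 ≠ a0.1)
    (lB : List ↥(Box d ℓ k fun _ : Fin (d + 1) => 2 * K)) (hl : IsNNChain a0 lB) (hlend : pathEnd a0 lB = a0')
    (hlen : (lB.length : ℝ) ≤ ((d : ℝ) + 1) * supNorm (a0'.1 - a0.1)) {α : ℝ} (hα0 : 0 ≤ α) (hα1 : α ≤ 1)
    (hH : ∀ Φ : ↥(Box d ℓ k fun _ : Fin (d + 1) => 2 * K) × ι → ℝ,
      ((((ℓ + 1) ^ k : ℕ) : ℝ) / supNorm (a0'.1 - a0.1)) ^ α *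
        siteNorm (transport (fieldLink F κ (boxFld ℓ k K Ac j)) a0 lB
            *ᵥ fld (derivA d F κ ℓ k (fun _ => 2 * K) (boxFld ℓ k K Ac j) μ
              *ᵥ (greenA d F κ ℓ k a m2 (fun _ => 2 * K) (baseEmb hn _) (stairContour hn _) (boxFld ℓ k K Ac j)
                *ᵥ Φ)) a0'
          - fld (derivA d F κ ℓ k (fun _ => 2 * K) (boxFld ℓ k K Ac j) μ
              *ᵥ (greenA d F κ ℓ k a m2 (fun _ => 2 * K) (baseEmb hn _) (stairContour hn _) (boxFld ℓ k K Ac j)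
                *ᵥ Φ)) a0)
        ≤ cH * supN Φ)
    (x y x' y' : ↥(fineDom ((ℓ + 1) ^ k) Ωc)) (l : List ↥(fineDom ((ℓ + 1) ^ k) Ωc))
    (hx : boxEmb ℓ k (fun _ => 2 * K) (cshift K j) (shift_mem_of_cube_subset hgood) a0 = x)
    (hy : boxEmb ℓ k (fun _ => 2 * K) (cshift K j) (shift_mem_of_cube_subset hgood) ⟨a0.1 + e1 μ, ha0μ⟩ = y)
    (hx' : boxEmb ℓ k (fun _ => 2 * K) (cshift K j) (shift_mem_of_cube_subset hgood) a0' = x')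
    (hy' : boxEmb ℓ k (fun _ => 2 * K) (cshift K j) (shift_mem_of_cube_subset hgood) ⟨a0'.1 + e1 μ, ha0'μ⟩ = y')
    (hlmap : lB.map (boxEmb ℓ k (fun _ => 2 * K) (cshift K j) (shift_mem_of_cube_subset hgood)) = l)
    (hrK : supNorm (x'.1 - x.1) ≤ (((ℓ + 1) ^ k : ℕ) : ℝ) * K)
    -- the four points and the contour lie in the `¾M`-core of `□_j`
    (hcore : ∀ z : ↥(fineDom ((ℓ + 1) ^ k) Ωc), (z = x ∨ z = y ∨ z = x' ∨ z = y' ∨ z ∈ l) →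
      ∀ ν, |rpos ((ℓ + 1) ^ k) Ωc z ν - ((((ℓ + 1) ^ k : ℕ) : ℝ) * K) * j ν| ≤ 3 / 4 * ((((ℓ + 1) ^ k : ℕ) : ℝ) * K)) :
    ‖((((ℓ + 1) ^ k : ℕ) : ℝ) * ((((ℓ + 1) ^ k : ℕ) : ℝ) / supNorm (x'.1 - x.1)) ^ α) •
        (unitOp x y' (transport (fieldLink F κ (acBond Ωc Ac)) x l * fieldLink F κ (acBond Ωc Ac) x' y')
          - unitOp x x' (transport (fieldLink F κ (acBond Ωc Ac)) x l)
          - (unitOp x y (fieldLink F κ (acBond Ωc Ac) x y) - unitOp x x 1))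
      * (mulH (ι := ι) (fun z => hCube ((((ℓ + 1) ^ k : ℕ) : ℝ) * K) j (rpos ((ℓ + 1) ^ k) Ωc z))
          * atGreen F κ ℓ k Ωc K Ac a m2 j
          * mulH (ι := ι) (fun z => hCube ((((ℓ + 1) ^ k : ℕ) : ℝ) * K) j (rpos ((ℓ + 1) ^ k) Ωc z)))‖
      ≤ Real.sqrt (Fintype.card ι) * (cH + ((d : ℝ) + 1) * D1 hprof * cD
          + ((d : ℝ) + 3) * (((d : ℝ) + 1) * (D1 hprof + D2 hprof)) * cD
          + ((d : ℝ) + 1) * (D1 hprof ^ 2 + D2 hprof) * cG) := by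
  have he := boxEmb_injective ℓ k (fun _ => 2 * K) (cshift K j) (shift_mem_of_cube_subset hgood)
  -- coordinate differences are those on the box
  have hsub : x'.1 - x.1 = a0'.1 - a0.1 := by rw [← hx, ← hx', boxEmb_sub_boxEmb]
  -- the cores of the box points
  have hcx := hcore x (Or.inl rfl)
  have hcy := hcore y (Or.inr (Or.inl rfl))
  have hcx' := hcore x' (Or.inr (Or.inr (Or.inl rfl)))
  have hcy' := hcore y' (Or.inr (Or.inr (Or.inr (Or.inl rfl))))
  rw [← hx] at hcx
  rw [← hy] at hcy
  rw [← hx'] at hcx'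
  rw [← hy'] at hcy'
  have hcl : ∀ c ∈ lB, ∀ ν, |rpos ((ℓ + 1) ^ k) Ωc
      (boxEmb ℓ k (fun _ => 2 * K) (cshift K j) (shift_mem_of_cube_subset hgood) c) ν
        - ((((ℓ + 1) ^ k : ℕ) : ℝ) * K) * j ν| ≤ 3 / 4 * ((((ℓ + 1) ^ k : ℕ) : ℝ) * K) := by
    intro c hc
    refine hcore _ (Or.inr (Or.inr (Or.inr (Or.inr ?_))))
    rw [← hlmap]
    exact List.mem_map_of_mem hc
  -- on the core the region's link variables are those of `Ã_j` on the box
  have hWcore : ∀ u v : ↥(Box d ℓ k fun _ : Fin (d + 1) => 2 * K),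
      (∀ ν, |rpos ((ℓ + 1) ^ k) Ωc (boxEmb ℓ k (fun _ => 2 * K) (cshift K j) (shift_mem_of_cube_subset hgood) u) ν
        - ((((ℓ + 1) ^ k : ℕ) : ℝ) * K) * j ν| ≤ 3 / 4 * ((((ℓ + 1) ^ k : ℕ) : ℝ) * K)) →
      (∀ ν, |rpos ((ℓ + 1) ^ k) Ωc (boxEmb ℓ k (fun _ => 2 * K) (cshift K j) (shift_mem_of_cube_subset hgood) v) ν
        - ((((ℓ + 1) ^ k : ℕ) : ℝ) * K) * j ν| ≤ 3 / 4 * ((((ℓ + 1) ^ k : ℕ) : ℝ) * K)) →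
      fieldLink F κ (acBond Ωc Ac) (boxEmb ℓ k (fun _ => 2 * K) (cshift K j) (shift_mem_of_cube_subset hgood) u)
          (boxEmb ℓ k (fun _ => 2 * K) (cshift K j) (shift_mem_of_cube_subset hgood) v)
        = fieldLink F κ (boxFld ℓ k K Ac j) u v := by
    intro u v hu hv
    unfold fieldLink
    rw [← subFieldB_atField ℓ k Ωc Ac hK hgood]
    show _ = F.U (κ * atField ℓ k Ωc K Ac j (boxEmb ℓ k (fun _ => 2 * K) (cshift K j) (shift_mem_of_cube_subset hgood) u)
      (boxEmb ℓ k (fun _ => 2 * K) (cshift K j) (shift_mem_of_cube_subset hgood) v))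
    rw [atField_core ℓ k Ωc Ac hK j _ _ hu hv]
  have hU : transport (fieldLink F κ (acBond Ωc Ac)) x l = transport (fieldLink F κ (boxFld ℓ k K Ac j)) a0 lB := by
    rw [← hlmap, ← hx, transport_map]
    refine transport_congr a0 lB fun u v hu hv => hWcore u v ?_ (hcl v hv)
    rcases hu with rfl | hu
    · exact hcx
    · exact hcl u hu
  have hWxy : fieldLink F κ (acBond Ωc Ac) x y = fieldLink F κ (boxFld ℓ k K Ac j) a0 ⟨a0.1 + e1 μ, ha0μ⟩ := by
    rw [← hx, ← hy]; exact hWcore _ _ hcx hcy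
  have hWx'y' : fieldLink F κ (acBond Ωc Ac) x' y' = fieldLink F κ (boxFld ℓ k K Ac j) a0' ⟨a0'.1 + e1 μ, ha0'μ⟩ := by
    rw [← hx', ← hy']; exact hWcore _ _ hcx' hcy'
  -- the probe is a padding
  have hP : ((((ℓ + 1) ^ k : ℕ) : ℝ) * ((((ℓ + 1) ^ k : ℕ) : ℝ) / supNorm (x'.1 - x.1)) ^ α) •
        (unitOp x y' (transport (fieldLink F κ (acBond Ωc Ac)) x l * fieldLink F κ (acBond Ωc Ac) x' y')
          - unitOp x x' (transport (fieldLink F κ (acBond Ωc Ac)) x l)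
          - (unitOp x y (fieldLink F κ (acBond Ωc Ac) x y) - unitOp x x 1))
      = pad (boxEmb ℓ k (fun _ => 2 * K) (cshift K j) (shift_mem_of_cube_subset hgood))
        (((((ℓ + 1) ^ k : ℕ) : ℝ) * ((((ℓ + 1) ^ k : ℕ) : ℝ) / supNorm (a0'.1 - a0.1)) ^ α) •
          (unitOp a0 ⟨a0'.1 + e1 μ, ha0'μ⟩ (transport (fieldLink F κ (boxFld ℓ k K Ac j)) a0 lB
              * fieldLink F κ (boxFld ℓ k K Ac j) a0' ⟨a0'.1 + e1 μ, ha0'μ⟩)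
            - unitOp a0 a0' (transport (fieldLink F κ (boxFld ℓ k K Ac j)) a0 lB)
            - (unitOp a0 ⟨a0.1 + e1 μ, ha0μ⟩ (fieldLink F κ (boxFld ℓ k K Ac j) a0 ⟨a0.1 + e1 μ, ha0μ⟩)
              - unitOp a0 a0 1))) := by
    rw [hU, hWxy, hWx'y', hsub, ← hx, ← hy, ← hx', ← hy', unitOp_eq_pad he, unitOp_eq_pad he, unitOp_eq_pad he,
      unitOp_eq_pad he, ← pad_sub, ← pad_sub, ← pad_sub, ← pad_smul]
  -- the letter is a padding
  have hA : mulH (ι := ι) (fun z => hCube ((((ℓ + 1) ^ k : ℕ) : ℝ) * K) j (rpos ((ℓ + 1) ^ k) Ωc z))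
        * atGreen F κ ℓ k Ωc K Ac a m2 j
        * mulH (ι := ι) (fun z => hCube ((((ℓ + 1) ^ k : ℕ) : ℝ) * K) j (rpos ((ℓ + 1) ^ k) Ωc z))
      = pad (boxEmb ℓ k (fun _ => 2 * K) (cshift K j) (shift_mem_of_cube_subset hgood))
        (mulH (ι := ι) (hBox ((ℓ + 1) ^ k) K (fun _ : Fin (d + 1) => 2 * K) (fun _ => 1))
          * greenA d F κ ℓ k a m2 (fun _ => 2 * K) (baseEmb hn _) (stairContour hn _) (boxFld ℓ k K Ac j)
          * mulH (ι := ι) (hBox ((ℓ + 1) ^ k) K (fun _ : Fin (d + 1) => 2 * K) (fun _ => 1))) := by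
    rw [atGreen_good F κ ℓ k Ωc K Ac a m2 hgood, cubeGreenB,
      letter_a_eq_pad (cubeS ℓ k Ωc K j) he (cubeS_iff_boxEmb ℓ k Ωc K hgood)
        (regWt ((ℓ + 1) ^ k) (fineDom ((ℓ + 1) ^ k) Ωc)) m2 _ (fun z hz => cubeS_of_hCube_ne_zero ℓ k Ωc hK j z hz),
      subFieldB_atField ℓ k Ωc Ac hK hgood]
    show pad _ (mulH (ι := ι) (fun b => hCube ((((ℓ + 1) ^ k : ℕ) : ℝ) * K) j
        (rpos ((ℓ + 1) ^ k) Ωc (boxEmb ℓ k (fun _ => 2 * K) (cshift K j) (shift_mem_of_cube_subset hgood) b))) * _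
      * mulH (ι := ι) (fun b => hCube ((((ℓ + 1) ^ k : ℕ) : ℝ) * K) j
        (rpos ((ℓ + 1) ^ k) Ωc (boxEmb ℓ k (fun _ => 2 * K) (cshift K j) (shift_mem_of_cube_subset hgood) b)))) = _
    rw [hCube_boxEmb ℓ k Ωc hK hgood]
  rw [hP, hA, pad_mul he, norm_pad he]
  have hrK' : supNorm (a0'.1 - a0.1) ≤ (((ℓ + 1) ^ k : ℕ) : ℝ) * K := hsub ▸ hrK
  exact holder_letter_box F κ hn hK hnK (fun _ => ⟨2, by ring⟩) (boxFld ℓ k K Ac j)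
    (fun u v => cubeField_antisymm _ _ _ _ _ u v) _ (fun _ => 1) hcG hcD hcH hG hDG μ a0 a0' ha0μ ha0'μ hne hrK'
    lB hl hlend hlen hα0 hα1 hH

end Letter

end

end Literature.MathematicalPhysics.QuantumFieldTheory.Balaban1983to89.B4HolderLetterRegion
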